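import Mathlib.RingTheory.Valuation.Basic
import Mathlib.Algebra.Order.GroupWithZero.Basic
import Mathlib.Tactic
import HarnessLib

set_option linter.dupNamespace false -- `Summit.BirchSwinnertonDyer.BirchSwinnertonDyer.Theorems.…` (summit = sub, D-0017)
set_option autoImplicit false

/-!
# Crux `ManinDatumSupercuspidalCMInert` (stmt-BirchSwinnertonDyer-20111, BED r605), CM side of H₇ — step (d) of memo PLAIN-ODD-57,
# third brick: sums `Σ_{j<N} a_j s^j` in a valued field, where `v(s)` generates the value group modulo the values `v(s)^{Nℤ}` of the
# coefficients — the valuation is the MAXIMUM of the terms (total ramification bookkeeping without local fields)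

Route `BiquadraticEisensteinDescent` (cell `pub/bsd-wall`, width seat `bsd-wall-cm-bed-w4` g11, RESOLVENT LANE; `--supports`
stmt-BirchSwinnertonDyer-20111, helper). THEOREMS ONLY (no definition, no named fact, no `sorry`); nothing is closed by this file and BSD is
not proved by any of it.

In the application `s = t_1 = x/y(Q_1)` is the uniformiser of `ℚ(i)(E₀[7])` at the unique place above `7` (`v(t_1)⁴⁸ = v 7`), the `a_j` lie
in `ℚ(i)` (so `v(a_j) ∈ v(7)^ℤ = v(t_1)^{48ℤ}`), and `N = 48`: the terms `a_j t_1^j` have pairwise distinct valuations `v(t_1)^{48m_j + j}`, so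

* `val_sum_mul_pow_eq` — `v(Σ_{j<N} a_j s^j) = max_j v(a_j s^j)`, attained at some `j` (or the sum and all terms vanish);
* `eq_zero_of_sum_mul_pow_eq_zero` — `Σ a_j s^j = 0 ⇒ a_j = 0 ∀ j` (the powers `1, s, …, s^{N−1}` are linearly independent over any subfield
  whose values lie in `v(s)^{Nℤ}` — the valuation-theoretic Eisenstein criterion giving `[ℚ(i)(t_1) : ℚ(i)] ≥ 48`);
* `val_sum_mul_pow_eq_of_val_eq` — the valuation of `Σ a_j s^j` only depends on `v(s)`: replacing `s` by `s′` with `v s′ = v s` does not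
  change it (ISOMETRY of `σ : t_1 ↦ t_u` on the power basis), and `val_sum_mul_pow_sub_lt_one` — for `v(Σ a_j s^j) ≤ 1`,
  `v(Σ a_j (s′^j − s^j)) < 1` (σ acts TRIVIALLY ON THE RESIDUE RING), `exists_zpow_of_sum_ne_zero` — `v(Σ a_j s^j) ∈ v(s)^ℤ` (the value
  group is generated by `v(s)`): the hypotheses `hv`, `hres`, `hgen` of `…TameResolvent.resolvent_valuation_le`.

References: [Serre1979] Ch. I §6 (Eisenstein equations, totally ramified extensions: `1, π, …, π^{e−1}` is an integral basis);
[CasselsFrohlich1967] Ch. I §5–§6.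
-/

noncomputable section

open scoped BigOperators

namespace Summit.BirchSwinnertonDyer.BirchSwinnertonDyer.Theorems.BiquadraticEisensteinDescentManinDatumSupercuspidalCMInertValuedPowerSums

variable {F Γ₀ : Type*} [Field F] [LinearOrderedCommGroupWithZero Γ₀] (v : Valuation F Γ₀)

/-- **Distinct exponents give distinct valuations.** For `0 < r < 1`, `0 < N`, `i ≠ j` below `N` and integers `m, m′`:
`r^(N m + i) ≠ r^(N m′ + j)`. [folklore] -/
theorem zpow_ne_zpow_of_lt {r : Γ₀} (hr0 : 0 < r) (hr1 : r < 1) {N : ℕ} {i j : ℕ} (hi : i < N) (hj : j < N) (hij : i ≠ j)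
    (m m' : ℤ) : r ^ ((N : ℤ) * m + i) ≠ r ^ ((N : ℤ) * m' + j) := by
  intro h
  have hinj : (N : ℤ) * m + i = (N : ℤ) * m' + j := by
    rcases lt_trichotomy ((N : ℤ) * m + i) ((N : ℤ) * m' + j) with hlt | heq | hgt
    · exact absurd h (ne_of_gt (zpow_lt_zpow_right_of_lt_one₀ hr0 hr1 hlt))
    · exact heq
    · exact absurd h (ne_of_lt (zpow_lt_zpow_right_of_lt_one₀ hr0 hr1 hgt))
  -- reduce modulo `N`
  have hmod : ((i : ℤ) - j) = (N : ℤ) * (m' - m) := by linear_combination hinj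
  have hN : (0 : ℤ) < N := by exact_mod_cast Nat.lt_of_le_of_lt (Nat.zero_le i) hi
  have habs : |(i : ℤ) - j| < N := by
    rw [abs_lt]; constructor <;> omega
  have hdvd : (N : ℤ) ∣ (i : ℤ) - j := ⟨m' - m, hmod⟩
  have h0 : (i : ℤ) - j = 0 := Int.eq_zero_of_abs_lt_dvd hdvd habs
  exact hij (by exact_mod_cast (sub_eq_zero.mp h0))

/-- **The valuation of `Σ_{j<N} a_j s^j` is the maximum of the terms**, when `v s = r` with `0 < r < 1` and every non-zero coefficient
has `v(a_j) ∈ r^{Nℤ}`: either all `a_j = 0`, or there is `j₀` with `a_{j₀} ≠ 0`, `v(Σ a_j s^j) = v(a_{j₀}) r^{j₀}` and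
`v(a_j) r^j ≤ v(a_{j₀}) r^{j₀}` for all `j` (the non-zero terms have pairwise distinct valuations). [cite: Serre1979, Ch. I §6 Prop. 17] -/
theorem val_sum_mul_pow_eq {N : ℕ} {s : F} {r : Γ₀} (hr0 : 0 < r) (hr1 : r < 1) (hs : v s = r) (a : Fin N → F)
    (ha : ∀ j, a j = 0 ∨ ∃ m : ℤ, v (a j) = r ^ ((N : ℤ) * m)) :
    (∀ j, a j = 0) ∨ ∃ j₀ : Fin N, a j₀ ≠ 0 ∧ v (∑ j, a j * s ^ (j : ℕ)) = v (a j₀) * r ^ (j₀ : ℕ) ∧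
      ∀ j, v (a j) * r ^ (j : ℕ) ≤ v (a j₀) * r ^ (j₀ : ℕ) := by
  classical
  by_cases hall : ∀ j, a j = 0
  · exact Or.inl hall
  right
  push Not at hall
  -- valuations of the terms
  have hterm : ∀ j, v (a j * s ^ (j : ℕ)) = v (a j) * r ^ (j : ℕ) := fun j ↦ by
    rw [Valuation.map_mul, Valuation.map_pow, hs]
  -- the non-zero terms have pairwise distinct valuations
  have hdist : ∀ i j : Fin N, a i ≠ 0 → a j ≠ 0 → i ≠ j → v (a i) * r ^ (i : ℕ) ≠ v (a j) * r ^ (j : ℕ) := by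
    intro i j hi hj hij
    obtain ⟨mi, hmi⟩ := (ha i).resolve_left hi
    obtain ⟨mj, hmj⟩ := (ha j).resolve_left hj
    rw [hmi, hmj, ← zpow_natCast, ← zpow_natCast, ← zpow_add₀ hr0.ne', ← zpow_add₀ hr0.ne']
    exact zpow_ne_zpow_of_lt hr0 hr1 i.isLt j.isLt (fun h ↦ hij (Fin.ext h)) mi mj
  -- pick `j₀` maximising `v (a j) * r ^ j`
  obtain ⟨j₀, -, hmax⟩ := Finset.exists_max_image Finset.univ (fun j : Fin N ↦ v (a j) * r ^ (j : ℕ))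
    (let ⟨j, _⟩ := hall; ⟨j, Finset.mem_univ _⟩)
  have hj₀ : a j₀ ≠ 0 := by
    obtain ⟨j, hj⟩ := hall
    intro h0
    have := hmax j (Finset.mem_univ _)
    rw [h0, Valuation.map_zero, zero_mul] at this
    have hpos : 0 < v (a j) * r ^ (j : ℕ) :=
      mul_pos (lt_of_le_of_ne zero_le (Ne.symm ((Valuation.ne_zero_iff v).mpr hj))) (pow_pos hr0 _)
    exact absurd this (not_le.mpr hpos)
  refine ⟨j₀, hj₀, ?_, fun j ↦ hmax j (Finset.mem_univ _)⟩
  -- the sum: the `j₀` term strictly dominates all others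
  rw [← Finset.add_sum_erase Finset.univ _ (Finset.mem_univ j₀)]
  have hlt : v (∑ j ∈ Finset.univ.erase j₀, a j * s ^ (j : ℕ)) < v (a j₀ * s ^ (j₀ : ℕ)) := by
    rw [hterm]
    have hne0 : v (a j₀) * r ^ (j₀ : ℕ) ≠ 0 :=
      (mul_pos (lt_of_le_of_ne zero_le (Ne.symm ((Valuation.ne_zero_iff v).mpr hj₀))) (pow_pos hr0 _)).ne'
    refine Valuation.map_sum_lt v hne0 fun j hj ↦ ?_
    rw [Finset.mem_erase] at hj
    rw [hterm]
    rcases eq_or_ne (a j) 0 with h0 | h0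
    · rw [h0, Valuation.map_zero, zero_mul]; exact lt_of_le_of_ne zero_le hne0.symm
    · exact lt_of_le_of_ne (hmax j (Finset.mem_univ _)) (hdist j j₀ h0 hj₀ hj.1)
  rw [Valuation.map_add_eq_of_lt_left v hlt, hterm]

/-- **Linear independence of `1, s, …, s^{N−1}`**: if `Σ_{j<N} a_j s^j = 0` with coefficients as above, all `a_j` vanish.
[cite: Serre1979, Ch. I §6 Prop. 17] -/
theorem eq_zero_of_sum_mul_pow_eq_zero {N : ℕ} {s : F} {r : Γ₀} (hr0 : 0 < r) (hr1 : r < 1) (hs : v s = r) (a : Fin N → F)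
    (ha : ∀ j, a j = 0 ∨ ∃ m : ℤ, v (a j) = r ^ ((N : ℤ) * m)) (h0 : ∑ j, a j * s ^ (j : ℕ) = 0) :
    ∀ j, a j = 0 := by
  rcases val_sum_mul_pow_eq v hr0 hr1 hs a ha with h | ⟨j₀, hj₀, hval, -⟩
  · exact h
  · exfalso
    rw [h0, Valuation.map_zero] at hval
    have hpos : 0 < v (a j₀) * r ^ (j₀ : ℕ) :=
      mul_pos (lt_of_le_of_ne zero_le (Ne.symm ((Valuation.ne_zero_iff v).mpr hj₀))) (pow_pos hr0 _)
    exact absurd hval hpos.ne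

/-- **The value group is generated by `v s`**: a non-zero `Σ a_j s^j` has valuation `r^m` for some `m ∈ ℤ`.
[cite: Serre1979, Ch. I §6 Prop. 17] -/
theorem exists_zpow_of_sum_ne_zero {N : ℕ} {s : F} {r : Γ₀} (hr0 : 0 < r) (hr1 : r < 1) (hs : v s = r) (a : Fin N → F)
    (ha : ∀ j, a j = 0 ∨ ∃ m : ℤ, v (a j) = r ^ ((N : ℤ) * m)) (h0 : ∑ j, a j * s ^ (j : ℕ) ≠ 0) :
    ∃ m : ℤ, v (∑ j, a j * s ^ (j : ℕ)) = r ^ m := by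
  rcases val_sum_mul_pow_eq v hr0 hr1 hs a ha with h | ⟨j₀, hj₀, hval, -⟩
  · exfalso; apply h0
    exact Finset.sum_eq_zero fun j _ ↦ by rw [h j, zero_mul]
  · obtain ⟨m, hm⟩ := (ha j₀).resolve_left hj₀
    refine ⟨(N : ℤ) * m + j₀, ?_⟩
    rw [hval, hm, zpow_add₀ hr0.ne', zpow_natCast]

/-- **Isometry on the power basis**: if `v s′ = v s = r` then `v(Σ a_j s′^j) = v(Σ a_j s^j)`. [cite: Serre1979, Ch. I §6 Prop. 17] -/
theorem val_sum_mul_pow_eq_of_val_eq {N : ℕ} {s s' : F} {r : Γ₀} (hr0 : 0 < r) (hr1 : r < 1) (hs : v s = r) (hs' : v s' = r)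
    (a : Fin N → F) (ha : ∀ j, a j = 0 ∨ ∃ m : ℤ, v (a j) = r ^ ((N : ℤ) * m)) :
    v (∑ j, a j * s' ^ (j : ℕ)) = v (∑ j, a j * s ^ (j : ℕ)) := by
  rcases val_sum_mul_pow_eq v hr0 hr1 hs a ha with h | ⟨j₀, hj₀, hval, hmax⟩
  · rw [Finset.sum_eq_zero fun j _ ↦ by rw [h j, zero_mul], Finset.sum_eq_zero fun j _ ↦ by rw [h j, zero_mul]]
  · rcases val_sum_mul_pow_eq v hr0 hr1 hs' a ha with h' | ⟨j₁, hj₁, hval', hmax'⟩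
    · exact absurd (h' j₀) hj₀
    · rw [hval, hval']
      exact le_antisymm (hmax j₁) (hmax' j₀)

/-- **Triviality on the residue ring**: if `v s′ = v s = r < 1` and `v(Σ a_j s^j) ≤ 1`, then `v(Σ a_j (s′^j − s^j)) < 1`
(every coefficient has `v(a_j) r^j ≤ 1`, hence `v(a_j) ≤ r^{−j}`; the `j = 0` term vanishes and for `j ≥ 1`,
`v(a_j (s′^j − s^j)) ≤ v(a_j) r^j = r^{Nm + j} ≤ 1` with `Nm + j ≠ 0`, so in fact `< 1`). [cite: Serre1979, Ch. IV §2 Prop. 7] -/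
theorem val_sum_mul_pow_sub_lt_one {N : ℕ} {s s' : F} {r : Γ₀} (hr0 : 0 < r) (hr1 : r < 1) (hs : v s = r) (hs' : v s' = r)
    (a : Fin N → F) (ha : ∀ j, a j = 0 ∨ ∃ m : ℤ, v (a j) = r ^ ((N : ℤ) * m))
    (hle : v (∑ j, a j * s ^ (j : ℕ)) ≤ 1) :
    v (∑ j, a j * (s' ^ (j : ℕ) - s ^ (j : ℕ))) < 1 := by
  -- each coefficient term is bounded by `1`
  have hbound : ∀ j, v (a j) * r ^ (j : ℕ) ≤ 1 := by
    rcases val_sum_mul_pow_eq v hr0 hr1 hs a ha with h | ⟨j₀, hj₀, hval, hmax⟩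
    · intro j; rw [h j, Valuation.map_zero, zero_mul]; exact zero_le_one
    · intro j; exact (hmax j).trans (hval ▸ hle)
  refine Valuation.map_sum_lt v one_ne_zero fun j _ ↦ ?_
  rcases eq_or_ne (a j) 0 with h0 | h0
  · rw [h0, zero_mul, Valuation.map_zero]; exact zero_lt_one
  rcases Nat.eq_zero_or_pos (j : ℕ) with hj | hj
  · rw [hj, pow_zero, pow_zero, sub_self, mul_zero, Valuation.map_zero]; exact zero_lt_one
  -- `j ≥ 1`: the term has valuation `≤ v(a_j) r^j = r^{Nm+j} ≤ 1`, and `≠ 1`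
  obtain ⟨m, hm⟩ := (ha j).resolve_left h0
  have hterm : v (a j * (s' ^ (j : ℕ) - s ^ (j : ℕ))) ≤ v (a j) * r ^ (j : ℕ) := by
    rw [Valuation.map_mul]
    refine mul_le_mul' le_rfl ?_
    refine Valuation.map_sub_le v ?_ ?_
    · rw [Valuation.map_pow, hs']
    · rw [Valuation.map_pow, hs]
  have hval : v (a j) * r ^ (j : ℕ) = r ^ ((N : ℤ) * m + j) := by
    rw [hm, zpow_add₀ hr0.ne', zpow_natCast]
  have hne : (N : ℤ) * m + j ≠ 0 := by
    intro h
    have hjN : (j : ℕ) < N := j.isLt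
    have : (N : ℤ) ∣ (j : ℕ) := ⟨-m, by linear_combination h⟩
    have hle' := Int.le_of_dvd (by exact_mod_cast hj) this
    omega
  have hlt : v (a j) * r ^ (j : ℕ) < 1 := by
    rw [hval]
    rcases lt_or_gt_of_ne hne with hneg | hpos
    · -- negative exponent would give valuation `> 1`, contradicting `≤ 1`
      exfalso
      have h1 : (1 : Γ₀) < r ^ ((N : ℤ) * m + j) := by
        have := zpow_lt_zpow_right_of_lt_one₀ hr0 hr1 hneg
        rwa [zpow_zero] at this
      exact absurd (hval ▸ hbound j) (not_le.mpr h1)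
    · have := zpow_lt_zpow_right_of_lt_one₀ hr0 hr1 hpos
      rwa [zpow_zero] at this
  exact lt_of_le_of_lt hterm hlt

end Summit.BirchSwinnertonDyer.BirchSwinnertonDyer.Theorems.BiquadraticEisensteinDescentManinDatumSupercuspidalCMInertValuedPowerSums

end
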